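import Mathlib
import Literature.Computability.Complexity.RangeAvoidance
import Summits.PneNP.PneNP.Theorems.PstarPairwise
import Summits.PneNP.PneNP.Theorems.PairwiseSALevel

/-!
# AND-pair laws over a 2-wise-uniform pattern set are pairwise independent (cell `pnp-ideate`, ROUND-22, blockLaw core)

FRONTIER range-avoidance ladder, rung F-N3 context (restricted-model lower bounds; nothing here bears on `P` vs `NP`).
Slots come in `E` pairs (`Fin (E + E)`: slot `castAdd e` and slot `natAdd e` form pair `e`); `andVec u e` is the AND of pair `e`.
For a bias `r` with `2r² = 1` the AND-bits of the `r`-product law are i.i.d. FAIR, so conditioning the product law on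
`andVec u ∈ 𝒜` for a non-empty pattern set `𝒜 ⊆ {0,1}^E` gives the law
`andLaw r 𝒜 u = (2^E/|𝒜|)·∏_s ρ_r(u_s)·[andVec u ∈ 𝒜]`.  If `𝒜` is 1- and 2-WISE UNIFORM (every coordinate, resp. pair of
coordinates, equidistributed on `𝒜`), then `andLaw r 𝒜` has total mass `1`, every slot marginal `ρ_r`, and PAIRWISE INDEPENDENT
slots (`andLaw_total`, `marg1_andLaw`, `marg2_andLaw`).  Instances: `𝒜` = a parity class of `{0,1}³` (the `IP₃` law of
`PstarIP3Law`), `𝒜` = a coset of the cut space of a simple graph (block laws of the ROUND-22 quotient construction).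
-/

set_option linter.dupNamespace false

open Finset
open Summit.PneNP.PneNP.Theorems.PstarPairwise (rho)
open Summit.PneNP.PneNP.Theorems.PairwiseSALevel (marg1 marg2)

namespace Summit.PneNP.PneNP.Theorems.AffineAndLaws

variable {E : ℕ}

/-! ## Pairs of slots -/

/-- The pair view of an assignment of the `E + E` slots. -/
def toPairs (u : Fin (E + E) → Bool) : Fin E → Bool × Bool := fun e => (u (Fin.castAdd E e), u (Fin.natAdd E e))

/-- The assignment with given pair values. -/
def ofPairs (p : Fin E → Bool × Bool) : Fin (E + E) → Bool := fun s => Fin.addCases (fun e => (p e).1) (fun e => (p e).2) s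

/-- Assignments of the slots ≃ assignments of the pairs. -/
def pairsEquiv : (Fin (E + E) → Bool) ≃ (Fin E → Bool × Bool) where
  toFun := toPairs
  invFun := ofPairs
  left_inv u := by
    funext s
    induction s using Fin.addCases with
    | left e => simp only [ofPairs, toPairs, Fin.addCases_left]
    | right e => simp only [ofPairs, toPairs, Fin.addCases_right]
  right_inv p := by
    funext e
    simp only [ofPairs, toPairs, Fin.addCases_left, Fin.addCases_right, Prod.mk.eta]

/-- The AND-vector of an assignment: one bit per pair. -/
def andVec (u : Fin (E + E) → Bool) : Fin E → Bool := fun e => u (Fin.castAdd E e) && u (Fin.natAdd E e)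

/-- The AND-vector of a pair assignment. -/
def andP (p : Fin E → Bool × Bool) : Fin E → Bool := fun e => (p e).1 && (p e).2

/-- The AND-vector through the pair view. -/
theorem andVec_eq (u : Fin (E + E) → Bool) : andVec u = andP (toPairs u) := rfl

/-- The `r`-product weight of an assignment. -/
noncomputable def wprod (r : ℝ) (u : Fin (E + E) → Bool) : ℝ := ∏ s, rho r (u s)

/-- The product weight, pair by pair. -/
theorem wprod_eq (r : ℝ) (u : Fin (E + E) → Bool) :
    wprod r u = ∏ e, (rho r (toPairs u e).1 * rho r (toPairs u e).2) := by
  unfold wprod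
  rw [Fin.prod_univ_add, ← Finset.prod_mul_distrib]
  rfl

/-- **The law**: the `r`-product law conditioned on `andVec u ∈ 𝒜`, normalised (for `2r² = 1`) by `2^E/|𝒜|`. -/
noncomputable def andLaw (r : ℝ) (A : Finset (Fin E → Bool)) (u : Fin (E + E) → Bool) : ℝ :=
  if andVec u ∈ A then (2 : ℝ) ^ E / A.card * wprod r u else 0

/-- Support. -/
theorem andLaw_support (r : ℝ) (A : Finset (Fin E → Bool)) (u : Fin (E + E) → Bool) (h : andLaw r A u ≠ 0) :
    andVec u ∈ A := by
  by_contra hne; exact h (if_neg hne)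

/-- Non-negativity for `0 ≤ r ≤ 1`. -/
theorem andLaw_nonneg {r : ℝ} (h0 : 0 ≤ r) (h1 : r ≤ 1) (A : Finset (Fin E → Bool)) (u : Fin (E + E) → Bool) :
    0 ≤ andLaw r A u := by
  unfold andLaw wprod
  split_ifs
  · refine mul_nonneg (by positivity) (Finset.prod_nonneg fun s _ => ?_)
    cases u s <;> simp [rho] <;> linarith
  · exact le_rfl

/-! ## The decomposition by AND-pattern -/

/-- The AND-fibre of a pattern, as a product set of pair values. -/
theorem filter_andP_eq (α : Fin E → Bool) :
    (univ.filter fun p : Fin E → Bool × Bool => andP p = α) =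
      Fintype.piFinset fun e => univ.filter fun x : Bool × Bool => (x.1 && x.2) = α e := by
  ext p
  simp only [Finset.mem_filter, Finset.mem_univ, true_and, Fintype.mem_piFinset, andP, funext_iff]

/-- **Decomposition**: a sum over slot assignments of `[andVec u ∈ 𝒜]·∏_e g_e(pair e)` is the sum over `α ∈ 𝒜` of the products
of the AND-fibre sums `Σ_{x : x₁∧x₂ = α_e} g_e(x)`. -/
theorem sum_andVec_prod (A : Finset (Fin E → Bool)) (g : Fin E → Bool × Bool → ℝ) :
    ∑ u : Fin (E + E) → Bool, (if andVec u ∈ A then ∏ e, g e (toPairs u e) else 0) =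
      ∑ α ∈ A, ∏ e, ∑ x ∈ univ.filter (fun x : Bool × Bool => (x.1 && x.2) = α e), g e x := by
  classical
  -- transport to pair assignments
  have h1 : ∑ u : Fin (E + E) → Bool, (if andVec u ∈ A then ∏ e, g e (toPairs u e) else 0) =
      ∑ p : Fin E → Bool × Bool, (if andP p ∈ A then ∏ e, g e (p e) else 0) := by
    refine Fintype.sum_equiv pairsEquiv _ _ fun u => ?_
    rfl
  rw [h1]
  -- split by the pattern
  have h2 : ∀ p : Fin E → Bool × Bool, (if andP p ∈ A then ∏ e, g e (p e) else 0) =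
      ∑ α ∈ A, if andP p = α then ∏ e, g e (p e) else 0 := by
    intro p
    by_cases hp : andP p ∈ A
    · rw [if_pos hp, Finset.sum_ite_eq, if_pos hp]
    · rw [if_neg hp, Finset.sum_eq_zero]
      intro α hα
      rw [if_neg]
      rintro rfl; exact hp hα
  simp_rw [h2]
  rw [Finset.sum_comm]
  refine Finset.sum_congr rfl fun α _ => ?_
  rw [← Finset.sum_filter, filter_andP_eq, Finset.prod_univ_sum]

/-! ## Pair tables -/

/-- The AND-fibre sums of a pair weight: `Σ_{x : x₁∧x₂ = τ} f x`. -/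
theorem sum_fibre_true (f : Bool × Bool → ℝ) :
    ∑ x ∈ univ.filter (fun x : Bool × Bool => (x.1 && x.2) = true), f x = f (true, true) := by
  rw [Finset.sum_filter]
  simp [Fintype.sum_prod_type]

/-- The `false`-fibre of AND has the three other points. -/
theorem sum_fibre_false (f : Bool × Bool → ℝ) :
    ∑ x ∈ univ.filter (fun x : Bool × Bool => (x.1 && x.2) = false), f x =
      f (false, false) + f (false, true) + f (true, false) := by
  rw [Finset.sum_filter]
  simp [Fintype.sum_prod_type]
  ring

/-! ## Uniformity sums -/

/-- `𝒜` is 1-wise uniform at `e`. -/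
def Unif1 (A : Finset (Fin E → Bool)) (e : Fin E) : Prop := ∀ τ : Bool, 2 * (A.filter fun α => α e = τ).card = A.card

/-- `𝒜` is 2-wise uniform at `e ≠ e'`. -/
def Unif2 (A : Finset (Fin E → Bool)) (e e' : Fin E) : Prop :=
  ∀ τ τ' : Bool, 4 * (A.filter fun α => α e = τ ∧ α e' = τ').card = A.card

/-- A sum over `𝒜` of a function of one coordinate, under 1-wise uniformity. -/
theorem sum_one_coord (A : Finset (Fin E → Bool)) (e : Fin E) (hA : Unif1 A e) (G : Bool → ℝ) :
    ∑ α ∈ A, G (α e) = (A.card : ℝ) / 2 * (G true + G false) := by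
  classical
  rw [← Finset.sum_filter_add_sum_filter_not A (fun α => α e = true)]
  have h1 : ∑ α ∈ A.filter (fun α => α e = true), G (α e) = ((A.filter fun α => α e = true).card : ℝ) * G true := by
    rw [Finset.sum_congr rfl (fun α hα => by rw [(Finset.mem_filter.1 hα).2]), Finset.sum_const, nsmul_eq_mul]
  have h2 : ∑ α ∈ A.filter (fun α => ¬α e = true), G (α e) = ((A.filter fun α => α e = false).card : ℝ) * G false := by
    have : (A.filter fun α => ¬α e = true) = A.filter fun α => α e = false := by
      ext α; simp
    rw [this, Finset.sum_congr rfl (fun α hα => by rw [(Finset.mem_filter.1 hα).2]), Finset.sum_const, nsmul_eq_mul]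
  rw [h1, h2]
  have ht : ((A.filter fun α => α e = true).card : ℝ) = A.card / 2 := by
    have := hA true; rw [eq_div_iff (by norm_num)]; exact_mod_cast (by linarith : _)
  have hf : ((A.filter fun α => α e = false).card : ℝ) = A.card / 2 := by
    have := hA false; rw [eq_div_iff (by norm_num)]; exact_mod_cast (by linarith : _)
  rw [ht, hf]; ring

/-- A sum over `𝒜` of a product of functions of two distinct coordinates, under 2-wise uniformity. -/
theorem sum_two_coord (A : Finset (Fin E → Bool)) (e e' : Fin E) (hA : Unif2 A e e') (G G' : Bool → ℝ) :
    ∑ α ∈ A, G (α e) * G' (α e') = (A.card : ℝ) / 4 * ((G true + G false) * (G' true + G' false)) := by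
  classical
  have hsplit : ∀ α ∈ A, G (α e) * G' (α e') =
      ∑ τ : Bool, ∑ τ' : Bool, if α e = τ ∧ α e' = τ' then G τ * G' τ' else 0 := by
    intro α _
    cases α e <;> cases α e' <;> simp
  rw [Finset.sum_congr rfl hsplit, Finset.sum_comm]
  have hin : ∀ τ : Bool, ∑ α ∈ A, ∑ τ' : Bool, (if α e = τ ∧ α e' = τ' then G τ * G' τ' else 0) =
      ∑ τ' : Bool, ((A.filter fun α => α e = τ ∧ α e' = τ').card : ℝ) * (G τ * G' τ') := by
    intro τ
    rw [Finset.sum_comm]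
    refine Finset.sum_congr rfl fun τ' _ => ?_
    rw [← Finset.sum_filter, Finset.sum_const, nsmul_eq_mul]
  simp_rw [hin]
  have hc : ∀ τ τ' : Bool, ((A.filter fun α => α e = τ ∧ α e' = τ').card : ℝ) = A.card / 4 := by
    intro τ τ'
    have := hA τ τ'; rw [eq_div_iff (by norm_num)]; exact_mod_cast (by linarith : _)
  simp_rw [hc]
  simp
  ring

end Summit.PneNP.PneNP.Theorems.AffineAndLaws
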